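import Mathlib

/-!
# Merge defect of two petals of a normalised multi-coin system

For a normalised value function `V(u) = c + ∑ ε_i u_i` with `c + ∑ ε_i = 1` (the shape of every petal value
`G_j / g` in the sunflower-partition model, `g52 §0`), the product of the values of two petals is compared with the
value of the MERGED petal `u ∘ v` (coordinatewise product of usages):

`V(u) V(v) − V(u∘v) = (∑ ε_i (u_i − 1)) (∑ ε_i (v_i − 1)) − ∑ ε_i (u_i − 1)(v_i − 1)`      (`merge_defect`).

Consequently two petals with PROPORTIONAL excess vectors (`v_i − 1 = λ (u_i − 1)`, `λ ≥ 0`) always merge favourably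
for upper bounds: `V(u) V(v) ≤ V(u∘v)` (`merge_le_of_proportional`), because `(∑ ε_i α_i)^2 ≤ (∑ ε_i)(∑ ε_i α_i^2) ≤
∑ ε_i α_i^2` (`sq_wsum_le_wsum_sq`).  These are the compression facts recorded in prove-1 gen 54, memo §7(g)(v),(viii):
same-coordinate usage favours merging, usage in different coordinates favours splitting (the defect is the bilinear
form with matrix `ε_i ε_j (i ≠ j)`, `−ε_i(1 − ε_i)` on the diagonal).  [this work]
-/

namespace Summit.CriticalPhenomena.PercolationContinuityZ3.Theorems.SunflowerPartition.SafeCalc.LinkedCurrency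

open Finset

variable {ι : Type*}

/-- **Merge defect identity.**  If `c + ∑_{i∈S} ε_i = 1` then
`(c + ∑ ε_i u_i)(c + ∑ ε_i v_i) − (c + ∑ ε_i u_i v_i) = (∑ ε_i (u_i−1))(∑ ε_i (v_i−1)) − ∑ ε_i (u_i−1)(v_i−1)`. [this work] -/
theorem merge_defect (S : Finset ι) (ε u v : ι → ℝ) (c : ℝ) (hc : c + ∑ i ∈ S, ε i = 1) :
    (c + ∑ i ∈ S, ε i * u i) * (c + ∑ i ∈ S, ε i * v i) - (c + ∑ i ∈ S, ε i * (u i * v i)) =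
      (∑ i ∈ S, ε i * (u i - 1)) * (∑ i ∈ S, ε i * (v i - 1)) - ∑ i ∈ S, ε i * ((u i - 1) * (v i - 1)) := by
  have hU : ∑ i ∈ S, ε i * (u i - 1) = ∑ i ∈ S, ε i * u i - ∑ i ∈ S, ε i := by
    rw [← sum_sub_distrib]; exact sum_congr rfl fun i _ => by ring
  have hW : ∑ i ∈ S, ε i * (v i - 1) = ∑ i ∈ S, ε i * v i - ∑ i ∈ S, ε i := by
    rw [← sum_sub_distrib]; exact sum_congr rfl fun i _ => by ring
  have hM : ∑ i ∈ S, ε i * ((u i - 1) * (v i - 1)) =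
      ∑ i ∈ S, ε i * (u i * v i) - ∑ i ∈ S, ε i * u i - ∑ i ∈ S, ε i * v i + ∑ i ∈ S, ε i := by
    rw [← sum_sub_distrib, ← sum_sub_distrib, ← sum_add_distrib]
    exact sum_congr rfl fun i _ => by ring
  have hc' : c = 1 - ∑ i ∈ S, ε i := by linarith
  rw [hU, hW, hM, hc']
  ring

/-- Weighted Cauchy–Schwarz / Jensen for the square: for weights `ε_i ≥ 0`,
`(∑ ε_i α_i)^2 ≤ (∑ ε_i) · ∑ ε_i α_i^2`. -/
theorem sq_wsum_le_sum_mul_wsum_sq (S : Finset ι) (ε α : ι → ℝ) (hε : ∀ i ∈ S, 0 ≤ ε i) :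
    (∑ i ∈ S, ε i * α i) ^ 2 ≤ (∑ i ∈ S, ε i) * ∑ i ∈ S, ε i * α i ^ 2 := by
  have key := sum_mul_sq_le_sq_mul_sq S (fun i => Real.sqrt (ε i)) (fun i => Real.sqrt (ε i) * α i)
  have h1 : ∑ i ∈ S, Real.sqrt (ε i) * (Real.sqrt (ε i) * α i) = ∑ i ∈ S, ε i * α i :=
    sum_congr rfl fun i hi => by
      rw [← mul_assoc, Real.mul_self_sqrt (hε i hi)]
  have h2 : ∑ i ∈ S, Real.sqrt (ε i) ^ 2 = ∑ i ∈ S, ε i :=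
    sum_congr rfl fun i hi => Real.sq_sqrt (hε i hi)
  have h3 : ∑ i ∈ S, (Real.sqrt (ε i) * α i) ^ 2 = ∑ i ∈ S, ε i * α i ^ 2 :=
    sum_congr rfl fun i hi => by rw [mul_pow, Real.sq_sqrt (hε i hi)]
  rw [h1, h2, h3] at key
  exact key

/-- For weights `ε_i ≥ 0` with total mass `∑ ε_i ≤ 1`:  `(∑ ε_i α_i)^2 ≤ ∑ ε_i α_i^2`. -/
theorem sq_wsum_le_wsum_sq (S : Finset ι) (ε α : ι → ℝ) (hε : ∀ i ∈ S, 0 ≤ ε i)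
    (hE : ∑ i ∈ S, ε i ≤ 1) :
    (∑ i ∈ S, ε i * α i) ^ 2 ≤ ∑ i ∈ S, ε i * α i ^ 2 := by
  have h := sq_wsum_le_sum_mul_wsum_sq S ε α hε
  have hQ : 0 ≤ ∑ i ∈ S, ε i * α i ^ 2 := sum_nonneg fun i hi => mul_nonneg (hε i hi) (sq_nonneg _)
  calc (∑ i ∈ S, ε i * α i) ^ 2 ≤ (∑ i ∈ S, ε i) * ∑ i ∈ S, ε i * α i ^ 2 := h
    _ ≤ 1 * ∑ i ∈ S, ε i * α i ^ 2 := mul_le_mul_of_nonneg_right hE hQ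
    _ = ∑ i ∈ S, ε i * α i ^ 2 := one_mul _

/-- **Proportional petals merge favourably.**  In a normalised multi-coin system (`ε_i ≥ 0`, `c + ∑ ε_i = 1`,
`c ≥ 0`), if the excess vector of the second petal is a nonnegative multiple of the first one's,
`v_i − 1 = λ (u_i − 1)` with `λ ≥ 0`, then the product of the two petal values is at most the value of the merged
petal: `(c + ∑ ε_i u_i)(c + ∑ ε_i v_i) ≤ c + ∑ ε_i u_i v_i`.  (No sign or cap condition on `u` is needed.) [this work] -/
theorem merge_le_of_proportional (S : Finset ι) (ε u v : ι → ℝ) (c lam : ℝ) (hε : ∀ i ∈ S, 0 ≤ ε i)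
    (hc0 : 0 ≤ c) (hc : c + ∑ i ∈ S, ε i = 1) (hlam : 0 ≤ lam)
    (hprop : ∀ i ∈ S, v i - 1 = lam * (u i - 1)) :
    (c + ∑ i ∈ S, ε i * u i) * (c + ∑ i ∈ S, ε i * v i) ≤ c + ∑ i ∈ S, ε i * (u i * v i) := by
  have hd := merge_defect S ε u v c hc
  have hE : ∑ i ∈ S, ε i ≤ 1 := by linarith
  -- rewrite the defect with `v_i − 1 = λ (u_i − 1)`
  have hW : ∑ i ∈ S, ε i * (v i - 1) = lam * ∑ i ∈ S, ε i * (u i - 1) := by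
    rw [mul_sum]; exact sum_congr rfl fun i hi => by rw [hprop i hi]; ring
  have hM : ∑ i ∈ S, ε i * ((u i - 1) * (v i - 1)) = lam * ∑ i ∈ S, ε i * (u i - 1) ^ 2 := by
    rw [mul_sum]; exact sum_congr rfl fun i hi => by rw [hprop i hi]; ring
  have hsq := sq_wsum_le_wsum_sq S ε (fun i => u i - 1) hε hE
  have : (∑ i ∈ S, ε i * (u i - 1)) * (∑ i ∈ S, ε i * (v i - 1)) -
      ∑ i ∈ S, ε i * ((u i - 1) * (v i - 1)) ≤ 0 := by
    rw [hW, hM]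
    have : (∑ i ∈ S, ε i * (u i - 1)) * (lam * ∑ i ∈ S, ε i * (u i - 1)) =
        lam * (∑ i ∈ S, ε i * (u i - 1)) ^ 2 := by ring
    rw [this]
    nlinarith [mul_le_mul_of_nonneg_left hsq hlam]
  linarith

/-- **The one-coordinate case** (the classical one-coin fact used throughout the sunflower calculus): for
`0 ≤ ε ≤ 1` and any reals `x, y`, `(1 + ε(x−1))(1 + ε(y−1)) − (1 + ε(xy−1)) = −ε(1−ε)(x−1)(y−1)`; in particular it is
`≤ 0` when `x, y ≥ 1`. [this work] -/
theorem one_coin_merge (ε x y : ℝ) (hε0 : 0 ≤ ε) (hε1 : ε ≤ 1) (hx : 1 ≤ x) (hy : 1 ≤ y) :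
    (1 + ε * (x - 1)) * (1 + ε * (y - 1)) ≤ 1 + ε * (x * y - 1) := by
  nlinarith [mul_nonneg (mul_nonneg hε0 (sub_nonneg.2 hε1)) (mul_nonneg (sub_nonneg.2 hx) (sub_nonneg.2 hy))]

/-- **Different coordinates favour splitting**: two one-coordinate petals in DIFFERENT coordinates have a nonnegative
merge defect `ε₁ ε₂ (x−1)(y−1)` — the cross term that (RES0′) must pay from unused budget (memo §7(g)(v)). [this work] -/
theorem two_coin_split (c ε₁ ε₂ x y : ℝ) (hc : c + ε₁ + ε₂ = 1) :
    (c + ε₁ * x + ε₂) * (c + ε₁ + ε₂ * y) - (c + ε₁ * x + ε₂ * y) = ε₁ * ε₂ * (x - 1) * (y - 1) := by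
  have hc' : c = 1 - ε₁ - ε₂ := by linarith
  rw [hc']; ring

end Summit.CriticalPhenomena.PercolationContinuityZ3.Theorems.SunflowerPartition.SafeCalc.LinkedCurrency
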